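import Mathlib
import HarnessLib.Audit
import Summits.PneNP.PneNP.Theorems.PstarGateUnitCycleAffine
import Summits.PneNP.PneNP.Theorems.PstarChordBridgeCorner

/-!
# One GATED chord, node N6 (closed core): the CHAMBER TRICHOTOMY for the single gated cycle (E2; prover-1 g18)

FRONTIER range-avoidance ladder, rung F-N3 (`stmt-PneNP-19007`), cell `pnp-ideate` (`PstarGateNodesX.GateUnitCycleQuadX`; this seat's
`HOME/pnp-ideate-prover-1/g18/E2-PLAN.md` §2 B0); restricted-model proof complexity — nothing here bears on `P` versus `NP`.

`N = {e}` (closed core = the cycle `D e + e`), any second constraint `q = q_{(1,0)}`.  On the gate chamber `H₁ = x₀ + coordKer {u}`,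
`x₀ = (κ₀ + 1)·e_u` (where `ℓ ≡ 1`), (T3) forces `Q_{D e} ≡ γ_e + 1` on `Z(q)` (`caseP_forced`) and (M0) at `e` puts a point of `Z(q)` in `H₁`
(`PstarGateUnitCycleAffine.zpoint_of_single`).  Hence:

* `single_chamber_cases` — **either `#J₀ = 3`** (rank deficiency of `Q_{D e}` on the chamber, `PstarGateFibreRank`), **or** `Q_{D e}` has rank `≥ 4` on
  the chamber, `Z(q) ∩ H₁ ≠ ∅`, and by `PstarPathRankFibre.forcing_cases_fibre` one of (EQ) `Q_{D e} = q + κ`, (EXC) `Q_{D e} = q + ν₁ν₂ + κ`,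
  (NOR) `q = (β + b^⊥)(α + a^⊥) + 1`, `Q_{D e} + (γ+1) = (…+1) m₁ + (…+1) m₂` holds ON THE CHAMBER (the alternative `q ≡ 1` there is excluded by the
  (M0) point).  With `q` affine only `#J₀ = 3` survives (`gateUnitCycleAffineX_holds`); for node N6 (`q` not affine) the three chamber regimes are
  what remains to be counted.
-/

set_option linter.dupNamespace false -- `Summit.PneNP.PneNP.…`: summit = sub-problem name (D-0017 single-conjunct layout)

open Finset Module Literature.Computability.Complexity
open Summit.PneNP.PneNP.Theorems.PstarTyped (Typed)
open Summit.PneNP.PneNP.Theorems.PstarSALevel (BoundaryExpanding SimpleOverlap)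
open Summit.PneNP.PneNP.Theorems.PstarCoreBound (XorClosed)
open Summit.PneNP.PneNP.Theorems.PstarCubeIdeals (IsAffineFn)
open Summit.PneNP.PneNP.Theorems.PstarProductRank (qform polar)
open Summit.PneNP.PneNP.Theorems.PstarQuadRank (rad)
open Summit.PneNP.PneNP.Theorems.PstarPathRankFibre (coordKer mem_coordKer forcing_cases_fibre)
open Summit.PneNP.PneNP.Theorems.PstarReadSumset (V2)
open Summit.PneNP.PneNP.Theorems.PstarChordSystem (ChordSystem)
open Summit.PneNP.PneNP.Theorems.PstarChordBridgeTools (privs coef)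
open Summit.PneNP.PneNP.Theorems.PstarChordBridge (BridgeData sys Solution Lift)
open Summit.PneNP.PneNP.Theorems.PstarChordBridgeCotree (Peelable)
open Summit.PneNP.PneNP.Theorems.PstarChordBridgeForcing (gam qform_add')
open Summit.PneNP.PneNP.Theorems.PstarChordBridgeBasis (qDir polarDir)
open Summit.PneNP.PneNP.Theorems.PstarChordBridgeCorner (qDir_add)
open Summit.PneNP.PneNP.Theorems.PstarNorUnitRegime (J₀_eq_of_single)
open Summit.PneNP.PneNP.Theorems.PstarGateBridge (GateHyp caseP_forced)
open Summit.PneNP.PneNP.Theorems.PstarGateFibreRank (card_eq_two_of_not_rank_four)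
open Summit.PneNP.PneNP.Theorems.PstarGateNodes (GateData)
open Summit.PneNP.PneNP.Theorems.PstarGateNodesX (GateDataX)
open Summit.PneNP.PneNP.Theorems.PstarGateUnitCycleAffine (zpoint_of_single)

namespace Summit.PneNP.PneNP.Theorems.PstarGateUnitCycleChamber

variable {n m : ℕ}

/-- **The chamber trichotomy for the single gated cycle** (see the module docstring). -/
theorem single_chamber_cases (I : LocalMap 4 n m) (hI : I.IsPure xorAndPred) (hT : Typed I) (hS : SimpleOverlap I) {r : ℕ}
    (hB : BoundaryExpanding r I) {B : BridgeData n m} {e g₀ : Fin m} {u : Fin n} {κ₀ : ZMod 2} (hD : GateDataX I r B e g₀ u κ₀)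
    (hN : B.N = {e}) :
    B.J₀.card = 3 ∨
    (finrank (ZMod 2) (rad ((polar (B.D e) (fun j => I.vars j 2) (fun j => I.vars j 3)).restrict (coordKer ({u} : Finset (Fin n))))) + 4 ≤
        finrank (ZMod 2) (coordKer ({u} : Finset (Fin n))) ∧
      (∃ w : coordKer ({u} : Finset (Fin n)), qDir I B (1, 0) ((Pi.single u (κ₀ + 1) : Fin n → ZMod 2) + (w : Fin n → ZMod 2)) = 0) ∧
      (∀ w : coordKer ({u} : Finset (Fin n)), qDir I B (1, 0) ((Pi.single u (κ₀ + 1) : Fin n → ZMod 2) + (w : Fin n → ZMod 2)) = 0 →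
        qform (B.D e) (fun j => I.vars j 2) (fun j => I.vars j 3) ((Pi.single u (κ₀ + 1) : Fin n → ZMod 2) + (w : Fin n → ZMod 2)) = gam B e + 1) ∧
      ((∃ κ : ZMod 2, ∀ w : coordKer ({u} : Finset (Fin n)),
          qform (B.D e) (fun j => I.vars j 2) (fun j => I.vars j 3) ((Pi.single u (κ₀ + 1) : Fin n → ZMod 2) + (w : Fin n → ZMod 2)) =
            qDir I B (1, 0) ((Pi.single u (κ₀ + 1) : Fin n → ZMod 2) + (w : Fin n → ZMod 2)) + κ) ∨
        (∃ ν₁ ν₂ : coordKer ({u} : Finset (Fin n)) → ZMod 2, IsAffineFn ν₁ ∧ IsAffineFn ν₂ ∧ ∃ κ : ZMod 2,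
          ∀ w : coordKer ({u} : Finset (Fin n)),
            qform (B.D e) (fun j => I.vars j 2) (fun j => I.vars j 3) ((Pi.single u (κ₀ + 1) : Fin n → ZMod 2) + (w : Fin n → ZMod 2)) =
              qDir I B (1, 0) ((Pi.single u (κ₀ + 1) : Fin n → ZMod 2) + (w : Fin n → ZMod 2)) + ν₁ w * ν₂ w + κ) ∨
        (∃ a b : coordKer ({u} : Finset (Fin n)),
          ((polarDir I B (1, 0)).restrict (coordKer ({u} : Finset (Fin n)))) a b = 1 ∧
          (∀ w : coordKer ({u} : Finset (Fin n)),
            qDir I B (1, 0) ((Pi.single u (κ₀ + 1) : Fin n → ZMod 2) + (w : Fin n → ZMod 2)) =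
              (((polarDir I B (1, 0)).restrict (coordKer ({u} : Finset (Fin n)))) w b +
                  (qDir I B (1, 0) ((Pi.single u (κ₀ + 1) : Fin n → ZMod 2) + (b : Fin n → ZMod 2)) +
                    qDir I B (1, 0) ((Pi.single u (κ₀ + 1) : Fin n → ZMod 2) + ((0 : coordKer ({u} : Finset (Fin n))) : Fin n → ZMod 2)))) *
                (((polarDir I B (1, 0)).restrict (coordKer ({u} : Finset (Fin n)))) w a +
                  (qDir I B (1, 0) ((Pi.single u (κ₀ + 1) : Fin n → ZMod 2) + (a : Fin n → ZMod 2)) +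
                    qDir I B (1, 0) ((Pi.single u (κ₀ + 1) : Fin n → ZMod 2) + ((0 : coordKer ({u} : Finset (Fin n))) : Fin n → ZMod 2)))) + 1) ∧
          ∃ m₁ m₂ : coordKer ({u} : Finset (Fin n)) → ZMod 2, IsAffineFn m₁ ∧ IsAffineFn m₂ ∧
            ∀ w : coordKer ({u} : Finset (Fin n)),
              qform (B.D e) (fun j => I.vars j 2) (fun j => I.vars j 3) ((Pi.single u (κ₀ + 1) : Fin n → ZMod 2) + (w : Fin n → ZMod 2)) + (gam B e + 1) =
                (((polarDir I B (1, 0)).restrict (coordKer ({u} : Finset (Fin n)))) w b +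
                    (qDir I B (1, 0) ((Pi.single u (κ₀ + 1) : Fin n → ZMod 2) + (b : Fin n → ZMod 2)) +
                      qDir I B (1, 0) ((Pi.single u (κ₀ + 1) : Fin n → ZMod 2) + ((0 : coordKer ({u} : Finset (Fin n))) : Fin n → ZMod 2))) + 1) * m₁ w +
                  (((polarDir I B (1, 0)).restrict (coordKer ({u} : Finset (Fin n)))) w a +
                    (qDir I B (1, 0) ((Pi.single u (κ₀ + 1) : Fin n → ZMod 2) + (a : Fin n → ZMod 2)) +
                      qDir I B (1, 0) ((Pi.single u (κ₀ + 1) : Fin n → ZMod 2) + ((0 : coordKer ({u} : Finset (Fin n))) : Fin n → ZMod 2))) + 1) * m₂ w))) := by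
  classical
  obtain ⟨hX, hW, hr, hd₁, -, hL, hPe, -, hG, hg₀, hgv, -, -, -, -, hcoef, hT3, hM0⟩ := id hD
  set W : Submodule (ZMod 2) (Fin n → ZMod 2) := coordKer ({u} : Finset (Fin n)) with hWdef
  set x₀ : Fin n → ZMod 2 := Pi.single u (κ₀ + 1) with hx₀
  have he : e ∈ B.N := hG.1
  have hJr : B.J₀.card ≤ r := (card_le_card (subset_union_left.trans subset_union_left)).trans hr
  have hg₀J : g₀ ∉ B.J₀ := fun h => disjoint_left.1 hd₁ hg₀ h
  have heD : e ∉ B.D e := fun h => (mem_sdiff.1 (hW.hD e he h)).2 he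
  -- the coefficient on the chamber
  have hx₀u : x₀ u = κ₀ + 1 := by rw [hx₀, Pi.single_eq_same]
  have hcoef1 : ∀ w : W, coef I B.C₁ B.G₁ (I.vars e 2) (x₀ + (w : Fin n → ZMod 2)) = 1 := by
    intro w
    rw [hcoef, Pi.add_apply, hx₀u, (mem_coordKer.1 w.2) u (mem_singleton_self u), add_zero]
    have e2 : ∀ k : ZMod 2, k + (k + 1) = 1 := by decide
    exact e2 κ₀
  -- CASE P vacuously; (T3) on the chamber
  have hothers : ∀ e' ∈ B.N, e' ≠ e → False := fun e' he' hne => hne (by rw [hN] at he'; exact mem_singleton.1 he')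
  have hforced : ∀ x, qDir I B (1, 0) x = 0 → coef I B.C₁ B.G₁ (I.vars e 2) x ≠ 0 →
      qform (B.D e) (fun j => I.vars j 2) (fun j => I.vars j 3) x = gam B e + 1 :=
    fun x hq hc => (caseP_forced I hI hT hW hL hG hT3 (fun e' he' hne => (hothers e' he' hne).elim)
      (fun e' he' hne => (hothers e' he' hne).elim) hq).2 hc
  have hZ : ∀ w : W, qDir I B (1, 0) (x₀ + (w : Fin n → ZMod 2)) = 0 →
      qform (B.D e) (fun j => I.vars j 2) (fun j => I.vars j 3) (x₀ + (w : Fin n → ZMod 2)) = gam B e + 1 :=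
    fun w hw => hforced _ hw (by rw [hcoef1]; exact one_ne_zero)
  -- (M0) at `e`: a point of `Z(q)` in the chamber
  obtain ⟨a, hqa, hca⟩ := zpoint_of_single I hI hT hW hL hG hN hT3 (hM0 e (hW.hN he))
  have hau : a u = κ₀ + 1 := by
    rw [hcoef] at hca
    have e2 : ∀ k v : ZMod 2, k + v ≠ 0 → v = k + 1 := by decide
    exact e2 _ _ hca
  have haW : a + x₀ ∈ W := by
    rw [mem_coordKer]
    intro w hw
    rw [mem_singleton] at hw
    subst hw
    rw [Pi.add_apply, hau, hx₀u, CharTwo.add_self_eq_zero]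
  have hpt : ∃ w : W, qDir I B (1, 0) (x₀ + (w : Fin n → ZMod 2)) = 0 := by
    refine ⟨⟨a + x₀, haW⟩, ?_⟩
    have : x₀ + (a + x₀) = a := by
      ext v
      rw [Pi.add_apply, Pi.add_apply, add_comm (a v), ← add_assoc, CharTwo.add_self_eq_zero, zero_add]
    rw [Submodule.coe_mk, this]
    exact hqa
  by_cases hrank : finrank (ZMod 2) (rad ((polar (B.D e) (fun j => I.vars j 2) (fun j => I.vars j 3)).restrict W)) + 4 ≤ finrank (ZMod 2) W
  · right
    refine ⟨hrank, hpt, hZ, ?_⟩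
    rcases forcing_cases_fibre (qDir_add I B (1, 0)) (qform_add' I (B.D e)) W x₀ hrank hZ with h1 | hEQ | hEXC | hNOR
    · exfalso
      obtain ⟨w, hw⟩ := hpt
      rw [h1 w] at hw
      exact one_ne_zero hw
    · exact Or.inl hEQ
    · exact Or.inr (Or.inl hEXC)
    · exact Or.inr (Or.inr hNOR)
  · left
    have hrX : (insert g₀ (insert e (B.D e))).card ≤ r := by
      refine le_trans (card_le_card ?_) hr
      refine insert_subset (mem_union_left _ (mem_union_right _ hg₀)) ?_
      exact (insert_subset (hW.hN he) ((hW.hD e he).trans sdiff_subset)).trans (subset_union_left.trans subset_union_left)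
    obtain ⟨h2, -⟩ := card_eq_two_of_not_rank_four I hI hS hB hW hJr he hg₀J hgv hrX hrank
    rw [J₀_eq_of_single I hI hT hW hX hPe hN, card_insert_of_notMem heD, h2]

end Summit.PneNP.PneNP.Theorems.PstarGateUnitCycleChamber
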